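/-
Copyright (c) 2026 the pub-hodgecm-mathlib formalisation cell (harness21).  Prover seat hodgecm-mathlib-K2Liu-p07 (g3), Track B «K2-LIT»,
#184♮ = hLiu418 = `stmt-HodgeConjecture-24832`; #42S payer road, organ S1 (local Siegel–Weil spanning), ROAD W letter (m1)
(LEAD F0P6-plan (g14) BATCH #15 (2) «(G) μ via (m1) = p07»; organ lead's DESIGN-W3-v2 §0 (b); referee K2Liu-ref1 (g5) AUDIT-AW2 R2, G3).
-/
import Literature.NumberTheory.Automorphic.LocalPiSchwartzBruhatFourier      -- ★ `piPrimePowBall`, `setIntegral_piPrimePowBall_addChar_dotProduct`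
import Literature.NumberTheory.Automorphic.AddCharConductorExponent          -- ★ `primePowBall` algebra: `mul_mem_primePowBall_iff`
import Literature.NumberTheory.Automorphic.TateLocalZetaShells               -- ★ `secondCountableTopology_localField`
import Mathlib.MeasureTheory.Integral.Prod
import HarnessLib

/-!
# Crux `HLiu418`, #42S organ S1, ROAD W, letter (m1): ORTHOGONALITY ALONG A LINEAR BLOCK — THE MIDDLE-CELL PROFILE OF A LATTICE-PAIR WITNESS IS AN
# INDICATOR, HENCE PROPORTIONAL ACROSS THE TWO SPACES AND DILATION-INVARIANT

Cell `hodgecm-mathlib`, crux item hLiu418 = `stmt-HodgeConjecture-24832`; squad K2 ∕ K2Liu; LEAD F0P6-plan (g14), organ lead K2Liu-p06 (g4);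
prover K2Liu-p07 (g3).  THEOREMS ONLY (no `def`, no instance, no notation, no named-fact hypothesis, no `sorry`); lane
`--supports stmt-HodgeConjecture-24832 --as helper`.

WHY.  On the MIDDLE cell `P_Δ w₁ P_Δ` the local Siegel–Weil section of the organ's lattice-pair witness is (★ F6 `K2LiuLocalSWMiddleCellFunctional`, ★ F6c)
`F_Φ(w₁ x) = c · (Levi scalar) · ∫_{y₁} ψ_v(½⟨(y₁,0), c(x)(y₁,0)⟩) · (ΓΦ)((y₁,0)·a(x)) dy₁` — an oscillatory integral over the FLIPPED block.  For the witness
`ΓΦ = 1_{S₁²} − 1_{S₂²}` (`S₁ = 𝒪u + 𝒪u′ + 𝔭^kℓ ⊃ S₂ = 𝒪u + 𝔭u′ + 𝔭^kℓ`, `(u,u′)` a hyperbolic pair of `V′_w`) the set is `γ·(S₁ ∖ S₂)` — a PRODUCT of a box in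
the `u`-coordinate with a set `R` in the `(u′, ℓ)`-coordinates — and the phase is LINEAR in the `u`-coordinate (`h′(u,u) = 0`):
`⟨y, c y⟩ = y_u ⬝ᵥ η(y_{u′,ℓ}) + q(y_{u′,ℓ})`.  This file proves the resulting shape in the tree's local box currency (★ `piPrimePowBall`, any
non-archimedean local field `F`, any `ψ` of conductor exponent `m`):
* `setIntegral_piPrimePowBall_addChar_dotProduct_add` — `∫_{(𝔭^n)^ι} ψ(x ⬝ᵥ η + c) = ψ(c) · vol · 1[η ∈ (𝔭^{m−n})^ι]` (★ Weil VII §2 Prop. 2 + `ψ(a+b) = ψ a ψ b`);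
* **`setIntegral_prod_addChar_linearBlock`** — FUBINI: `∫_{R × (𝔭^n)^ι} ψ(y₂ ⬝ᵥ η(y₁) + q(y₁)) = vol((𝔭^n)^ι) · ∫_{R ∩ η⁻¹(𝔭^{m−n})^ι} ψ(q(y₁))`;
* **`setIntegral_prod_addChar_linearBlock_eq_ite`** — THE INDICATOR SHAPE: if on `R` the ball condition `η(y₁) ∈ (𝔭^{m−n})^ι` does not depend on `y₁`
  (the `u′`-coordinate is a UNIT on `S₁ ∖ S₂`) and implies `ψ(q(y₁)) = 1` (referee's G3 box condition `d·N(𝔭^k) ⊆ Tr(𝒪_E)`), the integral is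
  `vol((𝔭^n)^ι) · μ(R) · 1[η(y₀) ∈ (𝔭^{m−n})^ι]` — so two witnesses with the same `(u,u′)`-part have PROPORTIONAL middle profiles (the inert∕split
  `λ`-matching of DESIGN-W3-v2 §0 (b)), and
* `smul_mem_piPrimePowBall_iff_of_normAbs_eq_one` — the ball condition is invariant under `η ↦ u • η`, `‖u‖ = 1`: the middle profile is DILATION-INVARIANT
  under `𝒪_Fˣ` — hypothesis (d) of ★ `K2LiuLocalSWRamifiedMiddleCell.middleCell_comp_eq` for the ramified witness (`Ad(d_a)`: `c(x) ↦ a⁻¹c(x)`).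
The frame identification (which Y-model coordinates are the `u`-block; `η`, `q`, `R` for the lattice pair) is the consumer's (K2Liu-p01 (g8)'s `κ`,
★ `K2LiuYModelDeltaMinusCoordinate`, ★ (ii-a)).
References: [WeilBNT1967] Ch. VII §2 Prop. 2; [Weil1964] n° 13; [Kudla1994] §3; [KudlaSweet1997] §1.
HONEST LABEL.  Count-neutral helper: `HC_CM` is proved only modulo the 7 printed citations (2 remaining named inputs: hLiu418 = `stmt-HodgeConjecture-24832`,
h413 = `stmt-HodgeConjecture-24833`) until rung 0 closes.
-/

set_option autoImplicit false
set_option linter.dupNamespace false -- the mandated namespace repeats `HodgeConjecture.HodgeConjecture`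

noncomputable section

open MeasureTheory Set
open scoped NNReal ENNReal
open Literature.NumberTheory.Automorphic Literature.NumberTheory.GaloisRepresentations.IsNonarchimedeanLocalField

namespace Summit.HodgeConjecture.HodgeConjecture.Cruxes.HLiu418.K2LiuLinearBlockOrthogonality

variable {F : Type*} [Field F] [ValuativeRel F] [TopologicalSpace F] [IsNonarchimedeanLocalField F]
  {ι : Type*} [Fintype ι] [MeasurableSpace (ι → F)] [BorelSpace (ι → F)] (μ : Measure (ι → F)) [μ.IsAddHaarMeasure]
  {ψ : AddChar F Circle} {m : ℤ}

/-! ## §1 One block: `∫_{(𝔭^n)^ι} ψ(x ⬝ᵥ η + c)` -/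

open scoped Classical in
/-- **`∫_{(𝔭^n)^ι} ψ(⟨x, η⟩ + c) dμ(x) = ψ(c) · μ((𝔭^n)^ι) · 1[η ∈ (𝔭^{m−n})^ι]`** (`ψ` of conductor exponent `m`). [cite: WeilBNT1967, Ch. VII §2, Prop. 2] -/
theorem setIntegral_piPrimePowBall_addChar_dotProduct_add (hm : ψ.HasConductorExp m) (n : ℤ) (η : ι → F) (c : F) :
    ∫ x in piPrimePowBall F ι n, ((ψ (x ⬝ᵥ η + c) : Circle) : ℂ) ∂μ =
      ((ψ c : Circle) : ℂ) * (if η ∈ piPrimePowBall F ι (m - n) then (μ.real (piPrimePowBall F ι n) : ℂ) else 0) := by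
  have h : ∀ x : ι → F, ((ψ (x ⬝ᵥ η + c) : Circle) : ℂ) = ((ψ c : Circle) : ℂ) * ((ψ (x ⬝ᵥ η) : Circle) : ℂ) := fun x => by
    rw [AddChar.map_add_eq_mul, Circle.coe_mul, mul_comm]
  simp_rw [h]
  rw [integral_const_mul, setIntegral_piPrimePowBall_addChar_dotProduct μ hm n η]

omit [Fintype ι] [MeasurableSpace (ι → F)] [BorelSpace (ι → F)] in
/-- **DILATION BY A UNIT DOES NOT MOVE THE BALLS**: `u • η ∈ (𝔭^N)^ι ↔ η ∈ (𝔭^N)^ι` for `‖u‖_F = 1`. [cite: WeilBNT1967, Ch. II §2, Def. 2] -/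
theorem smul_mem_piPrimePowBall_iff_of_normAbs_eq_one {u : F} (hu : normAbs F u = 1) (N : ℤ) (η : ι → F) :
    u • η ∈ piPrimePowBall F ι N ↔ η ∈ piPrimePowBall F ι N := by
  have hu' : normAbs F u = ((residueFieldCard F : ℝ≥0)⁻¹) ^ (0 : ℤ) := by rw [zpow_zero, hu]
  simp only [mem_piPrimePowBall_iff, Pi.smul_apply, smul_eq_mul, mul_mem_primePowBall_iff hu', sub_zero]

/-! ## §2 A linear block inside a product: Fubini and the indicator shape -/

variable {κ : Type*} [MeasurableSpace (κ → F)] [BorelSpace (κ → F)] (ν : Measure (κ → F)) [SigmaFinite ν]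

open scoped Classical in
/-- **FUBINI ALONG A LINEAR BLOCK**: for a phase `ψ(y₂ ⬝ᵥ η(y₁) + q(y₁))` which is LINEAR in the block variable `y₂ ∈ (𝔭^n)^ι`,
`∫_{R × (𝔭^n)^ι} ψ(y₂ ⬝ᵥ η(y₁) + q(y₁)) d(ν × μ) = μ((𝔭^n)^ι) · ∫_{R ∩ η⁻¹((𝔭^{m−n})^ι)} ψ(q(y₁)) dν(y₁)` (`R` of finite measure, `η`, `q`, `ψ` continuous).
[cite: WeilBNT1967, Ch. VII §2, Prop. 2] [cite: Weil1964, n° 13] -/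
theorem setIntegral_prod_addChar_linearBlock (hm : ψ.HasConductorExp m) (hψ : Continuous ψ) (n : ℤ) {R : Set (κ → F)} (hR : MeasurableSet R)
    (hRν : ν R ≠ ∞) {η : (κ → F) → (ι → F)} (hη : Continuous η) {q : (κ → F) → F} (hq : Continuous q) :
    ∫ y in R ×ˢ piPrimePowBall F ι n, ((ψ (y.2 ⬝ᵥ η y.1 + q y.1) : Circle) : ℂ) ∂(ν.prod μ) =
      (μ.real (piPrimePowBall F ι n) : ℂ) *
        ∫ y₁ in R ∩ η ⁻¹' piPrimePowBall F ι (m - n), ((ψ (q y₁) : Circle) : ℂ) ∂ν := by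
  haveI : SecondCountableTopology F := secondCountableTopology_localField F
  -- the integrand is continuous and bounded by `1` on a set of finite measure
  have hcont : Continuous fun y : (κ → F) × (ι → F) => ((ψ (y.2 ⬝ᵥ η y.1 + q y.1) : Circle) : ℂ) := by
    refine continuous_subtype_val.comp (hψ.comp ?_)
    refine Continuous.add ?_ (hq.comp continuous_fst)
    simp only [dotProduct]
    exact continuous_finsetSum _ fun i _ => ((continuous_apply i).comp continuous_snd).mul ((continuous_apply i).comp (hη.comp continuous_fst))
  have hfin : (ν.prod μ) (R ×ˢ piPrimePowBall F ι n) ≠ ∞ := by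
    rw [Measure.prod_prod]
    exact ENNReal.mul_ne_top hRν (measure_piPrimePowBall_lt_top μ n).ne
  have hint : IntegrableOn (fun y : (κ → F) × (ι → F) => ((ψ (y.2 ⬝ᵥ η y.1 + q y.1) : Circle) : ℂ)) (R ×ˢ piPrimePowBall F ι n) (ν.prod μ) := by
    refine Measure.integrableOn_of_bounded (M := 1) hfin hcont.aestronglyMeasurable ?_
    exact Filter.Eventually.of_forall fun y => by rw [Circle.norm_coe]
  rw [setIntegral_prod _ hint]
  have hinner : ∀ y₁ : κ → F, ∫ y₂ in piPrimePowBall F ι n, ((ψ (y₂ ⬝ᵥ η y₁ + q y₁) : Circle) : ℂ) ∂μ =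
      ((ψ (q y₁) : Circle) : ℂ) * (if η y₁ ∈ piPrimePowBall F ι (m - n) then (μ.real (piPrimePowBall F ι n) : ℂ) else 0) := fun y₁ =>
    setIntegral_piPrimePowBall_addChar_dotProduct_add μ hm n (η y₁) (q y₁)
  simp_rw [hinner]
  rw [← integral_indicator (hR.inter (hη.measurable (measurableSet_piPrimePowBall (m - n)))), ← integral_indicator hR, ← integral_const_mul]
  refine integral_congr_ae (Filter.Eventually.of_forall fun y₁ => ?_)
  simp only [indicator, mem_inter_iff, mem_preimage]
  split_ifs with h1 h2 h3 <;> simp_all [mul_comm]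

open scoped Classical in
/-- **THE INDICATOR SHAPE OF THE MIDDLE PROFILE**: if on `R` the ball condition `η(y₁) ∈ (𝔭^{m−n})^ι` is the same for all `y₁` (the `u′`-coordinate is a
unit on `S₁ ∖ S₂`) and implies `ψ(q(y₁)) = 1` (the box condition `d·N(𝔭^k) ⊆ Tr(𝒪_E)`), then
`∫_{R × (𝔭^n)^ι} ψ(y₂ ⬝ᵥ η(y₁) + q(y₁)) = μ((𝔭^n)^ι) · ν(R) · 1[η(y₀) ∈ (𝔭^{m−n})^ι]` for any `y₀ ∈ R` — the profile depends on the datum only through ONE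
ball condition, so two such profiles are PROPORTIONAL and each is invariant under `η ↦ u•η`, `‖u‖ = 1` (`smul_mem_piPrimePowBall_iff_of_normAbs_eq_one`).
[cite: WeilBNT1967, Ch. VII §2, Prop. 2] [cite: Kudla1994, §3] [cite: KudlaSweet1997, §1] -/
theorem setIntegral_prod_addChar_linearBlock_eq_ite (hm : ψ.HasConductorExp m) (hψ : Continuous ψ) (n : ℤ) {R : Set (κ → F)}
    (hR : MeasurableSet R) (hRν : ν R ≠ ∞) {η : (κ → F) → (ι → F)} (hη : Continuous η) {q : (κ → F) → F} (hq : Continuous q)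
    (hunit : ∀ y₁ ∈ R, ∀ y₁' ∈ R, (η y₁ ∈ piPrimePowBall F ι (m - n) ↔ η y₁' ∈ piPrimePowBall F ι (m - n)))
    (hbox : ∀ y₁ ∈ R, η y₁ ∈ piPrimePowBall F ι (m - n) → ψ (q y₁) = 1) {y₀ : κ → F} (hy₀ : y₀ ∈ R) :
    ∫ y in R ×ˢ piPrimePowBall F ι n, ((ψ (y.2 ⬝ᵥ η y.1 + q y.1) : Circle) : ℂ) ∂(ν.prod μ) =
      (μ.real (piPrimePowBall F ι n) : ℂ) * (ν.real R : ℂ) * (if η y₀ ∈ piPrimePowBall F ι (m - n) then 1 else 0) := by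
  rw [setIntegral_prod_addChar_linearBlock μ ν hm hψ n hR hRν hη hq, mul_assoc]
  congr 1
  by_cases h0 : η y₀ ∈ piPrimePowBall F ι (m - n)
  · rw [if_pos h0, mul_one]
    have hRI : R ∩ η ⁻¹' piPrimePowBall F ι (m - n) = R :=
      inter_eq_left.2 fun y₁ hy₁ => (hunit y₁ hy₁ y₀ hy₀).2 h0
    rw [hRI]
    have h1 : ∫ y₁ in R, ((ψ (q y₁) : Circle) : ℂ) ∂ν = ∫ y₁ in R, (1 : ℂ) ∂ν :=
      setIntegral_congr_fun hR fun y₁ hy₁ => by rw [hbox y₁ hy₁ ((hunit y₁ hy₁ y₀ hy₀).2 h0), Circle.coe_one]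
    rw [h1, setIntegral_const, Complex.real_smul, mul_one]
  · rw [if_neg h0, mul_zero]
    have hRI : R ∩ η ⁻¹' piPrimePowBall F ι (m - n) = ∅ :=
      eq_empty_of_forall_notMem fun y₁ hy₁ => h0 ((hunit y₁ hy₁.1 y₀ hy₀).1 hy₁.2)
    rw [hRI, Measure.restrict_empty, integral_zero_measure]

end Summit.HodgeConjecture.HodgeConjecture.Cruxes.HLiu418.K2LiuLinearBlockOrthogonality
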